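import Mathlib
import Summits.KontsevichZagierPeriods.Zeta5Search.OddDepthWindows
import Summits.KontsevichZagierPeriods.Zeta5Search.CasoratianClassBoundProof
import HarnessLib

/-!
# ζ(5) search — odd-depth record windows in KERNEL shape: the regime dichotomy (gen-2 g21)

Cell `pub-zeta5` (HONEST FRAMING: systematic search; no irrationality claim unless certified), lineage gen-2 (planner) generation 21.

`OddDepthWindows.ccGuard_bRec` (gen-2 g13) turns census g17's digit-free guard `ccGuard (bRec n) p N = true` into the window digit
`v_p(Cas₇(b(n))) ≥ 4 − 2N` (`= casLB + 1`), but the guard carries the REGIME of the collinearity criterion (`ccRegime`: every class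
exponent `≥ −N` AND a multipole class AT `−N`), which is a lattice condition on `(n, p)`, not a θ-condition — so the guarded window
statements `RecWindowOddM29/M33` are not consumable by the record ray's denominator tables (`RecordRay.cell_core`, p3 g5), which need a
bound at EVERY prime of a θ-window.  This file removes the regime hypothesis ONCE AND FOR ALL: if every class exponent is `≥ −N`
(`N ≥ 4`) and the guard holds WHENEVER the regime does, then `v_p(Cas₇(b(n))) ≥ 4 − 2N` at the instance — because off the regime no
multipole class sits at `−N`, and then THEOREM LB alone (`casLB_ge_or_noPole` with `A = −N`, `B = 4 − N`, + `casoratianClassBound_holds`)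
already gives `casLB ≥ 4 − 2N`.  Consumers: the machine-generated O-letter windows `OddWindowN15`, … (census g30 REC-BRICKS-LEDGER §4,
letters `O1`).  `p`-adic valuations of explicit rationals; nothing in this file bears on irrationality.
-/

open Finset

namespace Summit.KontsevichZagierPeriods.Zeta5Search.ResidueLaw

open Summit.KontsevichZagierPeriods.Zeta5Search.ClusterValuation
open Summit.KontsevichZagierPeriods.Zeta5Search.CasoratianValuation (InPolytope shift casoratian)
open Summit.KontsevichZagierPeriods.Zeta5Search.WedgeDictionary (dOf)

/-- A window prime with `p² > 41n+2`, `n ≥ 2` is at least `5`. -/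
private theorem five_le_of_sq_ker (n p : ℕ) (hn : 2 ≤ n) (h : 41 * n + 2 < p ^ 2) : 5 ≤ p := by
  by_contra hc
  have hp4 : p ≤ 4 := by omega
  have : p ^ 2 ≤ 4 ^ 2 := Nat.pow_le_pow_left hp4 2
  omega

/-- **THEOREM LB off the regime (PROVED)**: if every class exponent of `(bRec n, p)` is `≥ −N` (`N ≥ 4`) and NO multipole class has
exponent exactly `−N`, then `v_p(Cas₇(b(n))) ≥ 4 − 2N` — `casLB_ge_or_noPole` with `A = −N`, `B = 4 − N` (a multipole class has exponent
`≥ 1 − N`, so `3 + classExp ≥ 4 − N`) and `casoratianClassBound_holds`. -/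
theorem offRegime_bRec (n p N : ℕ) (hn : 2 ≤ n) (hp : p.Prime) (hsq : 41 * n + 2 < p ^ 2) (hN : 4 ≤ N)
    (hH0 : ∀ x, x < p → -(N : ℤ) ≤ classExp (bRec n) p x)
    (hno : ∀ x, x < p → 2 ≤ classPoleCount (bRec n) p x → classExp (bRec n) p x ≠ -(N : ℤ))
    (hne : casoratian (bRec n) 7 ≠ 0) :
    (4 : ℤ) - 2 * N ≤ padicValRat p (casoratian (bRec n) 7) := by
  haveI : Fact p.Prime := ⟨hp⟩
  have h5 : 5 ≤ p := five_le_of_sq_ker n p hn hsq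
  have hb0 : bRec n 0 = 41 * (n : ℤ) := by simp [bRec]; ring
  have hp2 : (bRec n 0 + 2 : ℤ) < (p : ℤ) ^ 2 := by rw [hb0]; exact_mod_cast hsq
  have hcb := casoratianClassBound_holds (bRec n) 7 p (inPolytope_bRec n) (by norm_num) (by norm_num)
    (inPolytope_shift_bRec n 7 (by omega) (by norm_num) (by norm_num)) hp h5 hp2 hne
  have hLB := casLB_ge_or_noPole (bRec n) p (-(N : ℤ)) (4 - (N : ℤ))
    (fun x hx _ => (hH0 x hx).trans (CellA.classExp_le_classNu (bRec n) p x)) (by omega)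
    (fun x hx hpole => by
      have h1 := hH0 x hx
      have h2 := hno x hx hpole
      omega)
    (fun _ => by omega)
  rcases hLB with ⟨h0, -⟩ | hge
  · rw [h0] at hcb; omega
  · omega

/-- **THE REGIME DICHOTOMY (PROVED; KERNEL shape of census g17's rung O on the record ray)**: at a record instance with `p ≤ 25n = d`,
`41n + 2 < p²`, `N ≥ 4`, if every class exponent is `≥ −N` and census g17's digit-free guard `ccGuard (bRec n) p N` holds WHENEVER its regime
`ccRegime (bRec n) p N` does, then `v_p(Cas₇(b(n))) ≥ 4 − 2N` — on the regime by `ccGuard_bRec` (tree theorem `collinearityCriterion_holds`),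
off the regime by `offRegime_bRec`.  No `ccRegime` / `NoDeepCentre` hypothesis survives: this is the shape `RecordRay.cell_core` consumes. -/
theorem oddWindow_bRec (n p N : ℕ) (hn : 2 ≤ n) (hp : p.Prime) (hpn : p ≤ 25 * n) (hsq : 41 * n + 2 < p ^ 2) (hN : 4 ≤ N)
    (hH0 : ∀ x, x < p → -(N : ℤ) ≤ classExp (bRec n) p x)
    (hG : ccRegime (bRec n) p N = true → ccGuard (bRec n) p N = true)
    (hne : casoratian (bRec n) 7 ≠ 0) :
    (4 : ℤ) - 2 * N ≤ padicValRat p (casoratian (bRec n) 7) := by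
  by_cases hR : ccRegime (bRec n) p N = true
  · exact ccGuard_bRec n p N hn hp hpn hsq (hG hR) hne
  · refine offRegime_bRec n p N hn hp hsq hN hH0 (fun x hx hpole hE => hR ?_) hne
    have hxm : x ∈ multipoleClasses (bRec n) p := by
      simp only [multipoleClasses, Finset.mem_filter, Finset.mem_range]
      exact ⟨hx, hpole⟩
    unfold ccRegime
    exact decide_eq_true ⟨hH0, x, hxm, hE⟩

end Summit.KontsevichZagierPeriods.Zeta5Search.ResidueLaw
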